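import Summits.Ventures.CertifiedArithmetic.Expansions.Orient3dStageB
import Summits.Ventures.CertifiedArithmetic.Expansions.EstimateRelativeError
import Mathlib.Tactic.NormNum

/-!
# Stage B of ORIENT3D is sound — the unconditional statements

NEW WORK in the sense of this development (a corollary file; nothing here is a literature fact).
`Orient3dStageB.lean` proves the soundness of the stage-B test of `orient3dadapt` with
`K = (3 + 32ε)ε` RELATIVE to one explicit hypothesis, the `3ε` relative error bound of `estimate` on
W-expansions of floats.  `EstimateRelativeError.lean` proves exactly that bound
(`abs_estimate_sub_sum_le_of_isWeakExpansion`, every round-to-nearest, `p ≥ 2`).  This file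
discharges the hypothesis: the three theorems below are `orient3dStageB_*_of_estimate` with `hest3`
supplied, and say nothing more.

* `orient3dStageB_correct` — `p ≥ 7`, `fl` a `RoundoffBelow 2` round-to-nearest into `F(p, emin)`,
  coordinates in `F(p, e₀)` with `emin ≤ e₀`, `emin + 2p ≤ 3e₀`, `tp` error-free on `F(p, e₀)²` and
  `F(p, 2e₀) × F(p, e₀)`: if stage B (coefficient `o3derrboundB32 p`, stage A's permanent) returns
  `d`, then `d > 0 ↔ (7) > 0` and `d < 0 ↔ (7) < 0` for the exact `orient3dDet`.
* `orient3dStageB_fma_correct`, `orient3dStageB_dekker_correct` — the FMA two-product; Dekker's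
  TWO-PRODUCT with `predicates.c`'s splitter (`p ≤ 2s ≤ p + 1`, rounding odd,
  `e₀ ≥ emin + p − 1`, `2e₀ ≥ emin + 2p − 1`).

HONEST CAVEATS, unchanged: exact model over `ℚ`, no overflow; for binary64 the format hypothesis
means coordinates that are multiples of `2^−322`; the certified coefficient is ours, `(3 + 32ε)ε`,
not `predicates.c`'s `(3 + 28ε)ε` (recorded in `Orient3dStageBMargins.lean`, not adjudicated);
stages C–D are not treated here.

References: J. R. Shewchuk, Discrete Comput. Geom. 18 (1997) 305–363, §4.4 and `predicates.c`
[Shewchuk1997].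
-/

namespace Summit.Ventures.CertifiedArithmetic.Expansions

open Literature.ComputerArithmetic.JeannerodRump2018
open Literature.ComputerArithmetic.BoldoJeannerodMelquiondMuller2023 hiding twoSum twoSum_fst
  isFloat_twoSum
open Literature.ComputerArithmetic.Shewchuk1997

variable {p : ℕ} {emin : ℤ} {fl : ℚ → ℚ}

/-- **THE STAGE-B TEST OF `orient3dadapt` IS SOUND with `K = (3 + 32ε)ε`** (`p ≥ 7`, any
`RoundoffBelow 2` round-to-nearest, coordinates in `F(p, e₀)` with `emin ≤ e₀`, `emin + 2p ≤ 3e₀`,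
two-product error-free on `F(p, e₀)²` and `F(p, 2e₀) × F(p, e₀)`): if stage B returns `d`, then
`d > 0 ↔ (7) > 0` and `d < 0 ↔ (7) < 0`. -/
theorem orient3dStageB_correct (hp : 7 ≤ p) (hfl : IsRoundNearest p emin fl)
    (hfl2 : RoundoffBelow 2 fl) {e₀ : ℤ} (he₀ : emin ≤ e₀) (h3 : emin + 2 * p ≤ e₀ + e₀ + e₀)
    {a₁ a₂ a₃ b₁ b₂ b₃ c₁ c₂ c₃ d₁ d₂ d₃ : ℚ}
    (ha₁ : IsFloat p e₀ a₁) (ha₂ : IsFloat p e₀ a₂) (ha₃ : IsFloat p e₀ a₃)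
    (hb₁ : IsFloat p e₀ b₁) (hb₂ : IsFloat p e₀ b₂) (hb₃ : IsFloat p e₀ b₃)
    (hc₁ : IsFloat p e₀ c₁) (hc₂ : IsFloat p e₀ c₂) (hc₃ : IsFloat p e₀ c₃)
    (hd₁ : IsFloat p e₀ d₁) (hd₂ : IsFloat p e₀ d₂) (hd₃ : IsFloat p e₀ d₃)
    {tp : ℚ → ℚ → ℚ × ℚ}
    (htp : ∀ x y, IsFloat p e₀ x → IsFloat p e₀ y → ExactTwoProd p emin fl tp x y)
    (htp' : ∀ x y, IsFloat p (e₀ + e₀) x → IsFloat p e₀ y → ExactTwoProd p emin fl tp x y)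
    {d : ℚ}
    (hB : orient3dStageB tp fl (o3derrboundB32 p)
      (orient3dPermanent fl a₁ a₂ a₃ b₁ b₂ b₃ c₁ c₂ c₃ d₁ d₂ d₃)
      a₁ a₂ a₃ b₁ b₂ b₃ c₁ c₂ c₃ d₁ d₂ d₃ = some d) :
    (0 < d ↔ 0 < orient3dDet a₁ a₂ a₃ b₁ b₂ b₃ c₁ c₂ c₃ d₁ d₂ d₃) ∧
      (d < 0 ↔ orient3dDet a₁ a₂ a₃ b₁ b₂ b₃ c₁ c₂ c₃ d₁ d₂ d₃ < 0) :=
  orient3dStageB_correct_of_estimate hp hfl hfl2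
    (fun _ hF hW =>
      abs_estimate_sub_sum_le_of_isWeakExpansion (le_trans (by norm_num) hp) hfl hF hW)
    he₀ h3 ha₁ ha₂ ha₃ hb₁ hb₂ hb₃ hc₁ hc₂ hc₃ hd₁ hd₂ hd₃ htp htp' hB

/-- **Stage B with the FMA two-product** is sound (`p ≥ 7`, any `RoundoffBelow 2`
round-to-nearest, coordinates in `F(p, e₀)` with `emin ≤ e₀`, `emin + 2p ≤ 3e₀`). -/
theorem orient3dStageB_fma_correct (hp : 7 ≤ p) (hfl : IsRoundNearest p emin fl)
    (hfl2 : RoundoffBelow 2 fl) {e₀ : ℤ} (he₀ : emin ≤ e₀) (h3 : emin + 2 * p ≤ e₀ + e₀ + e₀)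
    {a₁ a₂ a₃ b₁ b₂ b₃ c₁ c₂ c₃ d₁ d₂ d₃ : ℚ}
    (ha₁ : IsFloat p e₀ a₁) (ha₂ : IsFloat p e₀ a₂) (ha₃ : IsFloat p e₀ a₃)
    (hb₁ : IsFloat p e₀ b₁) (hb₂ : IsFloat p e₀ b₂) (hb₃ : IsFloat p e₀ b₃)
    (hc₁ : IsFloat p e₀ c₁) (hc₂ : IsFloat p e₀ c₂) (hc₃ : IsFloat p e₀ c₃)
    (hd₁ : IsFloat p e₀ d₁) (hd₂ : IsFloat p e₀ d₂) (hd₃ : IsFloat p e₀ d₃) {d : ℚ}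
    (hB : orient3dStageB (twoProdFMA fl) fl (o3derrboundB32 p)
      (orient3dPermanent fl a₁ a₂ a₃ b₁ b₂ b₃ c₁ c₂ c₃ d₁ d₂ d₃)
      a₁ a₂ a₃ b₁ b₂ b₃ c₁ c₂ c₃ d₁ d₂ d₃ = some d) :
    (0 < d ↔ 0 < orient3dDet a₁ a₂ a₃ b₁ b₂ b₃ c₁ c₂ c₃ d₁ d₂ d₃) ∧
      (d < 0 ↔ orient3dDet a₁ a₂ a₃ b₁ b₂ b₃ c₁ c₂ c₃ d₁ d₂ d₃ < 0) :=
  orient3dStageB_fma_correct_of_estimate hp hfl hfl2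
    (fun _ hF hW =>
      abs_estimate_sub_sum_le_of_isWeakExpansion (le_trans (by norm_num) hp) hfl hF hW)
    he₀ h3 ha₁ ha₂ ha₃ hb₁ hb₂ hb₃ hc₁ hc₂ hc₃ hd₁ hd₂ hd₃ hB

/-- **Stage B with Shewchuk's TWO-PRODUCT** (Dekker, split point `s`, `p ≤ 2s ≤ p + 1`, rounding
odd and `RoundoffBelow 2`) is sound (`p ≥ 7`, coordinates in `F(p, e₀)` with `e₀ ≥ emin + p − 1`,
`2e₀ ≥ emin + 2p − 1`, `3e₀ ≥ emin + 2p`). -/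
theorem orient3dStageB_dekker_correct (hp : 7 ≤ p) {s : ℕ} (hs2 : p ≤ 2 * s)
    (hs2' : 2 * s ≤ p + 1) (hfl : IsRoundNearest p emin fl) (hodd : ∀ t, fl (-t) = -fl t)
    (hfl2 : RoundoffBelow 2 fl) {e₀ : ℤ} (h1 : emin + p - 1 ≤ e₀)
    (h2 : emin + 2 * p - 1 ≤ e₀ + e₀) (h3 : emin + 2 * p ≤ e₀ + e₀ + e₀)
    {a₁ a₂ a₃ b₁ b₂ b₃ c₁ c₂ c₃ d₁ d₂ d₃ : ℚ}
    (ha₁ : IsFloat p e₀ a₁) (ha₂ : IsFloat p e₀ a₂) (ha₃ : IsFloat p e₀ a₃)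
    (hb₁ : IsFloat p e₀ b₁) (hb₂ : IsFloat p e₀ b₂) (hb₃ : IsFloat p e₀ b₃)
    (hc₁ : IsFloat p e₀ c₁) (hc₂ : IsFloat p e₀ c₂) (hc₃ : IsFloat p e₀ c₃)
    (hd₁ : IsFloat p e₀ d₁) (hd₂ : IsFloat p e₀ d₂) (hd₃ : IsFloat p e₀ d₃) {d : ℚ}
    (hB : orient3dStageB (twoProduct fl s) fl (o3derrboundB32 p)
      (orient3dPermanent fl a₁ a₂ a₃ b₁ b₂ b₃ c₁ c₂ c₃ d₁ d₂ d₃)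
      a₁ a₂ a₃ b₁ b₂ b₃ c₁ c₂ c₃ d₁ d₂ d₃ = some d) :
    (0 < d ↔ 0 < orient3dDet a₁ a₂ a₃ b₁ b₂ b₃ c₁ c₂ c₃ d₁ d₂ d₃) ∧
      (d < 0 ↔ orient3dDet a₁ a₂ a₃ b₁ b₂ b₃ c₁ c₂ c₃ d₁ d₂ d₃ < 0) :=
  orient3dStageB_dekker_correct_of_estimate hp hs2 hs2' hfl hodd hfl2
    (fun _ hF hW =>
      abs_estimate_sub_sum_le_of_isWeakExpansion (le_trans (by norm_num) hp) hfl hF hW)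
    h1 h2 h3 ha₁ ha₂ ha₃ hb₁ hb₂ hb₃ hc₁ hc₂ hc₃ hd₁ hd₂ hd₃ hB

end Summit.Ventures.CertifiedArithmetic.Expansions
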